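import Literature.MathematicalPhysics.QuantumFieldTheory.Balaban1983to89.T4RelativeCombWindow
import Literature.MathematicalPhysics.QuantumFieldTheory.Balaban1983to89.T4RelativeCombCrossing

/-!
# `Balaban1983to89.T4RelativeCombFactorisedPatch` — the factorised response under an ARBITRARY unitary-like gauge,
# and two neighbouring blocks patched: crossing bonds for FACTORISED (complexified) pairs, LINEAR constants

CITATION HEADER (lean-in-tree rule 2026-08-18).  Kernel certificate, on the CONCRETE `ℤ^d` carriers of
`T4RelativeComb`, of an ELEMENTARY cell-side estimate wanted by the audit cell `pub-balaban` (T4-DAG v17 carved row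
`T4-O3.E-NE1′-OG1′-RESID°`, parts (i) "complexified window" and (iii) "crossing bonds / patching"; self-row
`T4-O3.E-NE1′-OG1′-FACTPATCH*` of unit `b2b-balaban-pv04` gen 14).  It COMBINES two leaves of the same lineage and adds
nothing printed: `T4RelativeCombWindow` §7 (v1.2) proved the FACTORISED RESPONSE — for pairs `𝐔ᵢ = Wᵢ ⊙ Uᵢ` (bondwise
products `fmul`, `Uᵢ` unitary-like "𝔊-valued parts", `Wᵢ` arbitrary units "complex factors near 1", the factorisation
being DATA) the gauge-fixed relative bond variable factorises EXACTLY as `(g_x·W₁(b)·g_x⁻¹)·[(U₁^g)(b)·U₀(b)⁻¹]·W₀(b)⁻¹`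
for ANY gauge `g` (`T4RelativeCombWindow.factorised_response`) with the LINEAR norm bound
`T4RelativeCombWindow.norm_factorised_sub_one_le`, but packaged it only for the ONE-BLOCK comb gauge;
`T4RelativeCombCrossing` proved the unitary TWO-BLOCK statement (`two_block_bound_comb`: the relative comb gauges of two
neighbouring blocks `B(c₋)`, `B(c₊)` patched into one unitary-like gauge `patchGauge`, every bond of `B(c₋) ∪ B(c₊)` —
interior, tree and CROSSING — controlled by `crossConst d L·(q₁ + q₀)` plus the one free number
`X_c = ‖(U₁^g)(b₀)·U₀(b₀)⁻¹ − 1‖` of the corner crossing bond).  Here: §1 the factorised response for an ARBITRARY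
unitary-like gauge field (`factorised_pert_eq`, `factorised_bound_gauge`: `‖pert(𝐔₀, 𝐔₁^g)(b) − 1‖ ≤
M·(n₁·δ_b + w + 2·γ_x·t₀)` from the unitary relative deviation `δ_b ≥ ‖(U₁^g)(b)U₀(b)⁻¹ − 1‖` and `γ_x ≥ ‖g_x − 1‖`);
§2 the patched gauge of the unitary parts (`norm_patchGauge_sub_one_le`: `‖g_x − 1‖ ≤ d(L−1)·ε` on `B(c₋) ∪ B(c₊)` when the
unitary parts differ by `≤ ε` on the bonds of the pair) and THE TWO-BLOCK FACTORISED BOUND (`factorised_two_block_bound`: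
on every bond of the pair `‖pert(𝐔₀, 𝐔₁^g)(b) − 1‖ ≤ M·(n₁·(crossConst d L·(q₁ + q₀) + X_c) + w + 2·d(L−1)ε·t₀)`;
`factorised_two_block_bound_crude` without relative transport smallness: `… + 4t₀`); §3 non-vacuity.

PRINTED STATUS.  NOTHING printed enters any declaration; every declaration is [folklore] and kernel-proved.  The
MOTIVATION is the printed mechanism for complexified configurations as LOCATED by the cell's literature seat (GAPS
A-t4lit1-3 with UPDATE A-t4lit1-3a): complexified configurations are FACTORISED «𝐔 = U′U, U has values in the group
G» ([Balaban1987RG1] (1.11) p. 262 — quoted verbatim, CONTEXT ONLY, in the header of `T4RelativeCombWindow` v1.1 from the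
render read by this seat), the factor `U′` near `1` carried with LINEAR, first-order bounds; ONE complexified
configuration IS put in a generalized axial gauge by a Gᶜ-valued `v`, first order ([Balaban1987RG1] (3.26) p. 275,
quoted verbatim CONTEXT ONLY in the same header), and a complex perturbation `V′V₀` of a regular unitary `V₀` IS taken
as the reference of the relative block axial gauges at the printed price «the constant e^{O(1)L²α₀} on the right-hand
side is replaced by e^{O(1)(L²α₀+Lα₁)}» ([Balaban1985Averaging] p. 43, the paragraph before Proposition 7, quoted
verbatim CONTEXT ONLY in the v1.4 paragraph of the header of `T4RelativeCombWindow` from the render read by this seat;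
GAPS A-t4lit1-3b, which WITHDRAWS the located-absence clause «print has NO RELATIVE gauge fixing of a non-unitary
PAIR» of A-t4lit1-3a that v1/v1.1 quoted here); and the unitary two-block statement is this lineage's typed form of the
locality remark of
[Balaban1985RegularSpaces] Lemma 1, p. 80 (quoted CONTEXT ONLY in the header of `T4RelativeCombCrossing`).  No sentence of
either paper is used here; the cite tags of the imported files are theirs.

HONEST SCOPE.  (i) Sup norms; two neighbouring blocks `B(c₋) ∪ B(c₊)` of side `L` (corner `y`, direction `μ`); the
curvature hypotheses `q₁, q₀` and the bond-deviation hypothesis `ε` are on the 𝔊-VALUED PARTS `U₁, U₀` (printed analogue: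
(1.11), CONTEXT), the complex factors enter only through `‖W₁‖ ≤ n₁`, `‖W₁ − W₀‖ ≤ w`, `‖W₀ − 1‖ ≤ t₀`, `‖W₀⁻¹‖ ≤ M` on the
bonds from sites of the pair — no exponential map, no curvature of the full `𝐔`.  (ii) The free number `X_c` of
`T4RelativeCombCrossing` (the corner crossing bond, fixed downstream by the average condition — §7 of that file) stays a
PARAMETER, exactly as in the unitary statement.  (iii) The gauge is the patched comb gauge OF THE UNITARY PARTS
(unitary-like): NO conjugation cost, no `windowCost`; the complex factors' relative deviation `w` is NOT gauged away
anywhere (CONTEXT: ONE configuration in a generalized axial gauge — [Balaban1987RG1] (3.26), Gᶜ-valued `v`, first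
order; a complex perturbation as the REFERENCE of the relative gauges at the price `e^{O(1)(L²α₀+Lα₁)}` —
[Balaban1985Averaging] p. 43; the cell's own, with no located printed counterpart (GAPS A-t4lit1-3b, A-t4lit16-1 / -2):
the non-unitary TWO-configuration crossing / patching typed here).  (iv) Nothing about
Hölder norms (carved row part (ii), another lineage), more than two blocks, Bałaban's averages, windows or
renormalization transformations.  Value = kernel bookkeeping (a two-line combination of two accepted leaves, made so that
a consumer can cite ONE name); NOT summit progress.
v1.1 = COMMENT-ONLY DOCFIX (two CONTEXT phrases of PRINTED STATUS / HONEST SCOPE (iii) aligned with GAPS A-t4lit1-3a, as in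
`T4RelativeCombWindow` v1.3; declarations byte-identical to v1).  v1.2 (2026-08-19) = COMMENT-ONLY DOCFIX of the same
two phrases per GAPS A-t4lit1-3b ([Balaban1985Averaging] p. 43 located: complex reference of the relative block axial
gauges, printed price), as in `T4RelativeCombWindow` v1.4; declarations byte-identical to v1 / v1.1.
-/

namespace Literature.MathematicalPhysics.QuantumFieldTheory.Balaban1983to89.T4RelativeCombFactorisedPatch

open B8Lemma1Lattice (e site InBlock InPair yplus)
open T4RelativeLadder (UnitaryLike)
open T4RelativeComb (Cfg gaugeAct plaq combGauge unitaryLike_combGauge norm_combGauge_sub_one_le)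
open T4RelativeCombWindow (fmul factorised_response norm_factorised_sub_one_le norm_sub_one_le_two_of_unitaryLike)
open T4RelativeCombCrossing (pert patchGauge unitaryLike_patchGauge patchGauge_of_left patchGauge_of_right PlaqSupPair
  crossConst two_block_bound_comb)

variable {R : Type*} [NormedRing R] {d : ℕ}

/-- [folklore] Sites of `ℤ^d` (the same carrier as `T4RelativeComb.Site d`, definitionally). -/
abbrev Site (d : ℕ) : Type := Fin d → ℤ

example (d : ℕ) : Site d = T4RelativeComb.Site d := rfl

/-! ## §1  The factorised response under an ARBITRARY unitary-like gauge field -/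

/-- [folklore] `T4RelativeCombWindow.factorised_response` in the `pert` notation of `T4RelativeCombCrossing`
(`pert U₀ V b = V(b)·U₀(b)⁻¹`): for ANY gauge field `g`,
`pert(W₀⊙U₀, (W₁⊙U₁)^g)(b) = (g_x·W₁(b)·g_x⁻¹)·pert(U₀, U₁^g)(b)·W₀(b)⁻¹`. -/
theorem factorised_pert_eq (g : Site d → Rˣ) (W₀ U₀ W₁ U₁ : Cfg d R) (x : Site d) (ν : Fin d) :
    pert (fmul W₀ U₀) (gaugeAct g (fmul W₁ U₁)) x ν =
      (g x * W₁ x ν * (g x)⁻¹) * pert U₀ (gaugeAct g U₁) x ν * (W₀ x ν)⁻¹ := by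
  show gaugeAct g (fmul W₁ U₁) x ν * (fmul W₀ U₀ x ν)⁻¹ =
    (g x * W₁ x ν * (g x)⁻¹) * (gaugeAct g U₁ x ν * (U₀ x ν)⁻¹) * (W₀ x ν)⁻¹
  exact factorised_response g W₀ U₀ W₁ U₁ x ν

/-- [folklore] THE FACTORISED RESPONSE FOR AN ARBITRARY GAUGE FIELD, unitary-like AT THE SITE `x`: on the bond
`b = ⟨x, x+e_ν⟩`, `‖pert(𝐔₀, 𝐔₁^g)(b) − 1‖ ≤ M·(n₁·δ + w + 2·γ·t₀)` whenever the UNITARY relative bond variable satisfies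
`‖pert(U₀, U₁^g)(b) − 1‖ ≤ δ` and `‖g_x − 1‖ ≤ γ`, `‖W₁(b)‖ ≤ n₁`, `‖W₁(b) − W₀(b)‖ ≤ w`, `‖W₀(b) − 1‖ ≤ t₀`, `‖W₀(b)⁻¹‖ ≤ M`
(`T4RelativeCombWindow.norm_factorised_sub_one_le`; the comb, patched, or any other unitary-like gauge). -/
theorem factorised_bound_gauge [NormOneClass R] {g : Site d → Rˣ} {U₀ U₁ W₀ W₁ : Cfg d R} {x : Site d} {ν : Fin d}
    {δ γ n₁ w t₀ M : ℝ} (hg : UnitaryLike (g x))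
    (hδ : ‖(pert U₀ (gaugeAct g U₁) x ν : R) - 1‖ ≤ δ) (hγ : ‖(g x : R) - 1‖ ≤ γ)
    (hn₁ : ‖(W₁ x ν : R)‖ ≤ n₁) (hw : ‖(W₁ x ν : R) - W₀ x ν‖ ≤ w) (ht₀ : ‖(W₀ x ν : R) - 1‖ ≤ t₀)
    (hM : ‖(((W₀ x ν)⁻¹ : Rˣ) : R)‖ ≤ M) :
    ‖(pert (fmul W₀ U₀) (gaugeAct g (fmul W₁ U₁)) x ν : R) - 1‖ ≤ M * (n₁ * δ + w + 2 * γ * t₀) := by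
  rw [factorised_pert_eq]
  push_cast
  have h := norm_factorised_sub_one_le (W₁ := W₁ x ν) (W₀ := W₀ x ν) hg (pert U₀ (gaugeAct g U₁) x ν : R)
  have e1 : ‖(W₁ x ν : R)‖ * ‖(pert U₀ (gaugeAct g U₁) x ν : R) - 1‖ ≤ n₁ * δ :=
    mul_le_mul hn₁ hδ (norm_nonneg _) ((norm_nonneg _).trans hn₁)
  have e2 : 2 * ‖(g x : R) - 1‖ * ‖(W₀ x ν : R) - 1‖ ≤ 2 * γ * t₀ := by
    have := mul_le_mul hγ ht₀ (norm_nonneg _) ((norm_nonneg _).trans hγ)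
    linarith
  have hsum : ‖(W₁ x ν : R)‖ * ‖(pert U₀ (gaugeAct g U₁) x ν : R) - 1‖ + ‖(W₁ x ν : R) - W₀ x ν‖
      + 2 * ‖(g x : R) - 1‖ * ‖(W₀ x ν : R) - 1‖ ≤ n₁ * δ + w + 2 * γ * t₀ :=
    add_le_add (add_le_add e1 hw) e2
  have h0 : 0 ≤ ‖(W₁ x ν : R)‖ * ‖(pert U₀ (gaugeAct g U₁) x ν : R) - 1‖ + ‖(W₁ x ν : R) - W₀ x ν‖
      + 2 * ‖(g x : R) - 1‖ * ‖(W₀ x ν : R) - 1‖ := by positivity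
  calc _ ≤ _ := h
    _ ≤ (n₁ * δ + w + 2 * γ * t₀) * M := mul_le_mul hsum hM (norm_nonneg _) (h0.trans hsum)
    _ = M * (n₁ * δ + w + 2 * γ * t₀) := mul_comm _ _

/-! ## §2  Two neighbouring blocks: the patched comb gauge of the unitary parts carries the complex factors -/

/-- [folklore] TRANSPORT SIZE OF THE PATCHED GAUGE: if the unitary parts differ by at most `ε` on the bonds from sites of
`B(c₋) ∪ B(c₊)` (both ends in the pair), then `‖g_x − 1‖ ≤ d(L−1)·ε` for every `x` of the pair — on `B(c₋)` the patched
gauge is the comb gauge of `B(c₋)`, on `B(c₊)` that of `B(c₊)` (`T4RelativeCombCrossing.patchGauge_of_left/right`), and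
each is `T4RelativeComb.norm_combGauge_sub_one_le`. -/
theorem norm_patchGauge_sub_one_le [NormOneClass R] {U₀ U₁ : Cfg d R} {L : ℕ} {y : Site d} {μ : Fin d} {ε : ℝ}
    (hU₀ : ∀ x ν, UnitaryLike (U₀ x ν)) (hU₁ : ∀ x ν, UnitaryLike (U₁ x ν)) (hε : 0 ≤ ε)
    (hdev : ∀ x ν, InPair L y μ x → InPair L y μ (x + e ν) → ‖(U₁ x ν : R) - U₀ x ν‖ ≤ ε)
    (x : Site d) (hx : InPair L y μ x) :
    ‖(patchGauge L y μ U₀ U₁ x : R) - 1‖ ≤ (d : ℝ) * ((L : ℝ) - 1) * ε := by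
  rcases hx with hx | hx
  · rw [patchGauge_of_left U₀ U₁ hx]
    exact norm_combGauge_sub_one_le hU₀ (fun x' ν' => (hU₁ x' ν').1) hε
      (fun x' ν' h1 h2 => hdev x' ν' (Or.inl h1) (Or.inl h2)) x hx
  · rw [patchGauge_of_right U₀ U₁ hx]
    exact norm_combGauge_sub_one_le hU₀ (fun x' ν' => (hU₁ x' ν').1) hε
      (fun x' ν' h1 h2 => hdev x' ν' (Or.inr h1) (Or.inr h2)) x hx

/-- [folklore] THE TWO-BLOCK FACTORISED BOUND: factorised pairs `𝐔ᵢ = Wᵢ ⊙ Uᵢ` with unitary-like parts whose curvatures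
are `≤ q₁`, `≤ q₀` on the plaquettes of `B(c₋) ∪ B(c₊)` and which differ by `≤ ε` on its bonds, complex factors with
`‖W₁‖ ≤ n₁`, `‖W₁ − W₀‖ ≤ w`, `‖W₀ − 1‖ ≤ t₀`, `‖W₀⁻¹‖ ≤ M` on the bonds from sites of the pair; in the PATCHED COMB GAUGE
`g = patchGauge L y μ U₀ U₁` OF THE UNITARY PARTS every bond `b` with both ends in the pair — interior, tree or crossing —
satisfies `‖pert(𝐔₀, 𝐔₁^g)(b) − 1‖ ≤ M·(n₁·(crossConst d L·(q₁ + q₀) + X_c) + w + 2·d(L−1)ε·t₀)`, `X_c` the unitary free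
number of `T4RelativeCombCrossing.two_block_bound_comb` (the corner crossing bond).  LINEAR; no `windowCost`. -/
theorem factorised_two_block_bound [NormOneClass R] {U₀ U₁ W₀ W₁ : Cfg d R} {L : ℕ} {y : Site d} {μ : Fin d}
    {q₁ q₀ ε n₁ w t₀ M : ℝ} (hU₀ : ∀ x ν, UnitaryLike (U₀ x ν)) (hU₁ : ∀ x ν, UnitaryLike (U₁ x ν)) (hL : 1 ≤ L)
    (hq₁ : PlaqSupPair L y μ (fun x ρ ν => ‖(plaq U₁ x ρ ν : R) - 1‖) q₁)
    (hq₀ : PlaqSupPair L y μ (fun x ρ ν => ‖(plaq U₀ x ρ ν : R) - 1‖) q₀) (hq : 0 ≤ q₁ + q₀) (hε : 0 ≤ ε)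
    (hdev : ∀ x ν, InPair L y μ x → InPair L y μ (x + e ν) → ‖(U₁ x ν : R) - U₀ x ν‖ ≤ ε)
    (hn₁ : ∀ x ν, InPair L y μ x → ‖(W₁ x ν : R)‖ ≤ n₁)
    (hw : ∀ x ν, InPair L y μ x → ‖(W₁ x ν : R) - W₀ x ν‖ ≤ w)
    (ht₀ : ∀ x ν, InPair L y μ x → ‖(W₀ x ν : R) - 1‖ ≤ t₀)
    (hM : ∀ x ν, InPair L y μ x → ‖(((W₀ x ν)⁻¹ : Rˣ) : R)‖ ≤ M)
    (x : Site d) (ν : Fin d) (hx : InPair L y μ x) (hxν : InPair L y μ (x + e ν)) :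
    ‖(pert (fmul W₀ U₀) (gaugeAct (patchGauge L y μ U₀ U₁) (fmul W₁ U₁)) x ν : R) - 1‖ ≤
      M * (n₁ * (crossConst d L * (q₁ + q₀) +
        ‖(pert U₀ (gaugeAct (patchGauge L y μ U₀ U₁) U₁) (site y (Pi.single μ (L - 1))) μ : R) - 1‖) + w
        + 2 * ((d : ℝ) * ((L : ℝ) - 1) * ε) * t₀) :=
  factorised_bound_gauge (unitaryLike_patchGauge hU₀ hU₁ L y μ x)
    (two_block_bound_comb hU₀ hU₁ hL hq₁ hq₀ hq x ν hx hxν) (norm_patchGauge_sub_one_le hU₀ hU₁ hε hdev x hx)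
    (hn₁ x ν hx) (hw x ν hx) (ht₀ x ν hx) (hM x ν hx)

/-- [folklore] The same WITHOUT relative transport smallness (`‖g_x − 1‖ ≤ 2` only,
`T4RelativeCombWindow.norm_sub_one_le_two_of_unitaryLike`): `… + 4·t₀`, first order in the complex factor of `0`. -/
theorem factorised_two_block_bound_crude [NormOneClass R] {U₀ U₁ W₀ W₁ : Cfg d R} {L : ℕ} {y : Site d} {μ : Fin d}
    {q₁ q₀ n₁ w t₀ M : ℝ} (hU₀ : ∀ x ν, UnitaryLike (U₀ x ν)) (hU₁ : ∀ x ν, UnitaryLike (U₁ x ν)) (hL : 1 ≤ L)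
    (hq₁ : PlaqSupPair L y μ (fun x ρ ν => ‖(plaq U₁ x ρ ν : R) - 1‖) q₁)
    (hq₀ : PlaqSupPair L y μ (fun x ρ ν => ‖(plaq U₀ x ρ ν : R) - 1‖) q₀) (hq : 0 ≤ q₁ + q₀)
    (hn₁ : ∀ x ν, InPair L y μ x → ‖(W₁ x ν : R)‖ ≤ n₁)
    (hw : ∀ x ν, InPair L y μ x → ‖(W₁ x ν : R) - W₀ x ν‖ ≤ w)
    (ht₀ : ∀ x ν, InPair L y μ x → ‖(W₀ x ν : R) - 1‖ ≤ t₀)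
    (hM : ∀ x ν, InPair L y μ x → ‖(((W₀ x ν)⁻¹ : Rˣ) : R)‖ ≤ M)
    (x : Site d) (ν : Fin d) (hx : InPair L y μ x) (hxν : InPair L y μ (x + e ν)) :
    ‖(pert (fmul W₀ U₀) (gaugeAct (patchGauge L y μ U₀ U₁) (fmul W₁ U₁)) x ν : R) - 1‖ ≤
      M * (n₁ * (crossConst d L * (q₁ + q₀) +
        ‖(pert U₀ (gaugeAct (patchGauge L y μ U₀ U₁) U₁) (site y (Pi.single μ (L - 1))) μ : R) - 1‖) + w + 4 * t₀) := by
  have h := factorised_bound_gauge (unitaryLike_patchGauge hU₀ hU₁ L y μ x)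
    (two_block_bound_comb hU₀ hU₁ hL hq₁ hq₀ hq x ν hx hxν)
    (norm_sub_one_le_two_of_unitaryLike (unitaryLike_patchGauge hU₀ hU₁ L y μ x))
    (hn₁ x ν hx) (hw x ν hx) (ht₀ x ν hx) (hM x ν hx)
  have e4 : (2 : ℝ) * 2 * t₀ = 4 * t₀ := by ring
  rwa [e4] at h

/-! ## §3  Non-vacuity -/

/-- Non-vacuity (over `ℝ`, any `d`): for the flat pair `𝐔₀ = 𝐔₁ = 1 ⊙ 1` and the trivial gauge field every hypothesis of
`factorised_bound_gauge` holds with `δ = γ = w = t₀ = 0`, `n₁ = M = 1`, and the conclusion reads `0 ≤ 0`. -/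
example (x : Site d) (ν : Fin d) :
    ‖(pert (fmul (fun _ _ => (1 : ℝˣ)) (fun _ _ => 1))
        (gaugeAct (fun _ => (1 : ℝˣ)) (fmul (fun _ _ => (1 : ℝˣ)) (fun _ _ => 1))) x ν : ℝ) - 1‖ ≤
      1 * (1 * 0 + 0 + 2 * 0 * 0) := by
  refine factorised_bound_gauge (g := fun _ => (1 : ℝˣ)) (U₀ := fun _ _ => 1) (U₁ := fun _ _ => 1)
    (W₀ := fun _ _ => 1) (W₁ := fun _ _ => 1) T4RelativeLadder.UnitaryLike.one ?_ ?_ ?_ ?_ ?_ ?_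
  · simp [pert, gaugeAct]
  all_goals simp

end Literature.MathematicalPhysics.QuantumFieldTheory.Balaban1983to89.T4RelativeCombFactorisedPatch
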